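import Mathlib.Algebra.Polynomial.Derivative
import Mathlib.Algebra.Polynomial.Div
import Mathlib.Algebra.Polynomial.Lifts
import Mathlib.Algebra.BigOperators.Fin
import Mathlib.FieldTheory.AlgebraicClosure
import Mathlib.FieldTheory.IsAlgClosed.Basic
import Mathlib.Analysis.Complex.Polynomial.Basic
import Mathlib.Algebra.Algebra.Hom.Rat

/-!
# `StokesGeneration` (stmt-KontsevichZagierPeriods-3586) — line `fibrewise_stokes`, stub `stub_loopLinearFactors`

Registered stub V3 (rung 9) of the line `fibrewise_stokes` of the crux `StokesGeneration`
(route UnfoldedStokes): **splitting a polynomial loop into linear loops in the right half-plane.**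
Given a complex polynomial loop `P = A + iB` (real polynomials `A, B` with `ℚ`-algebraic
coefficients, `A² + B² ≠ 0` on `[0,1]`), its angular derivative `Im(P′/P) = (A B′ − A′ B)/(A² + B²)`
on `[0,1]` is a finite sum of angular derivatives `(b c − a d)/((a u + b)² + (c u + d)²)` of LINEAR
loops `(a u + b) + i(c u + d)` with `ℚ`-algebraic real coefficients and `a u + b > 0` on `[0,1]`.

Proof: lift `A + iB` to a polynomial over the field `ℚ̄ = algebraicClosure ℚ ℂ` of complex algebraic
numbers (algebraically closed), and induct on the degree, peeling one root `w ∈ ℚ̄` at a time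
(`P = (X − w) Q`): the angular density `ω(z, z′) = (Re z · Im z′ − Re z′ · Im z)/|z|²` is additive
over products (Leibniz), and `ω` of the linear loop `u − w` is `Im w/((u − Re w)² + (Im w)²)`, which
vanishes for a real root and for `Im w ≠ 0` is the angular derivative of the rotated linear loop
`∓i(u − w) = |Im w| ∓ i(u − Re w)` (sign that of `Im w`), whose real part is the positive constant
`|Im w|`; `Re w`, `Im w` are real algebraic numbers. No definitions are introduced.
[folklore]
-/

noncomputable section

-- `Summit.KontsevichZagierPeriods.KontsevichZagierPeriods.…` is the tree's mandated layout (single-conjunct summit).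
set_option linter.dupNamespace false

namespace Summit.KontsevichZagierPeriods.KontsevichZagierPeriods.Cruxes.StokesGeneration.FibrewiseStokes

open Polynomial

/-! ## Pointwise algebra of the angular density `ω(z, z′) = (Re z · Im z′ − Re z′ · Im z)/|z|²` -/

/-- `z ≠ 0 ⇒ (Re z)² + (Im z)² ≠ 0`. [folklore] -/
private theorem loopLF_normSq_ne {z : ℂ} (hz : z ≠ 0) : z.re ^ 2 + z.im ^ 2 ≠ 0 := by
  have h : z.re ^ 2 + z.im ^ 2 = Complex.normSq z := by rw [Complex.normSq_apply]; ring
  rw [h]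
  exact (Complex.normSq_pos.2 hz).ne'

/-- Leibniz rule for the angular density: `ω(lq, l′q + lq′) = ω(l, l′) + ω(q, q′)` for `l, q ≠ 0`
(`Im(P′/P)` is additive over products of loops). [folklore] -/
private theorem loopLF_ang_mul (l l' q q' : ℂ) (hl : l ≠ 0) (hq : q ≠ 0) :
    ((l * q).re * (l' * q + l * q').im - (l' * q + l * q').re * (l * q).im) /
        ((l * q).re ^ 2 + (l * q).im ^ 2) =
      (l.re * l'.im - l'.re * l.im) / (l.re ^ 2 + l.im ^ 2) +
        (q.re * q'.im - q'.re * q.im) / (q.re ^ 2 + q.im ^ 2) := by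
  rw [div_add_div _ _ (loopLF_normSq_ne hl) (loopLF_normSq_ne hq),
    div_eq_div_iff (loopLF_normSq_ne (mul_ne_zero hl hq))
      (mul_ne_zero (loopLF_normSq_ne hl) (loopLF_normSq_ne hq))]
  simp only [Complex.mul_re, Complex.mul_im, Complex.add_re, Complex.add_im]
  ring

/-- Angular density of the linear loop `u − w` (derivative `1`): `Im w/((u − Re w)² + (Im w)²)`.
[folklore] -/
private theorem loopLF_ang_linear (w : ℂ) (u : ℝ) :
    (((u:ℂ) - w).re * (1:ℂ).im - (1:ℂ).re * ((u:ℂ) - w).im) /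
        (((u:ℂ) - w).re ^ 2 + ((u:ℂ) - w).im ^ 2) =
      w.im / ((u - w.re) ^ 2 + w.im ^ 2) := by
  simp only [Complex.sub_re, Complex.sub_im, Complex.ofReal_re, Complex.ofReal_im, Complex.one_re,
    Complex.one_im]
  ring

/-- The real and imaginary parts of a complex number algebraic over `ℚ` are algebraic over `ℚ`:
`re z = (z + z̄)/2`, `im z = (z − z̄)/(2i)` with `z̄` algebraic (complex conjugation is a
`ℚ`-algebra map) and `i` algebraic (`i² + 1 = 0`). [folklore] -/
-- adapted from `Literature.NumberTheory.Transcendental.KZPeriodsProofs.isAlgebraic_re_im`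
private theorem loopLF_re_im {z : ℂ} (hz : IsAlgebraic ℚ z) :
    IsAlgebraic ℚ z.re ∧ IsAlgebraic ℚ z.im := by
  have hconj : IsAlgebraic ℚ (starRingEnd ℂ z) :=
    hz.algHom ((starRingEnd ℂ : ℂ →+* ℂ).toRatAlgHom)
  have hI : IsAlgebraic ℚ Complex.I :=
    ⟨X ^ 2 + 1, by simpa using (monic_X_pow_add_C (1:ℚ) two_ne_zero).ne_zero, by simp⟩
  have h2 : IsAlgebraic ℚ (2 : ℂ)⁻¹ := (isAlgebraic_nat 2).inv
  have hre : IsAlgebraic ℚ (z.re : ℂ) := by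
    rw [Complex.re_eq_add_conj, div_eq_mul_inv]
    exact (hz.add hconj).mul h2
  have him : IsAlgebraic ℚ (z.im : ℂ) := by
    rw [Complex.im_eq_sub_conj, div_eq_mul_inv, mul_inv]
    exact (hz.sub hconj).mul (h2.mul hI.inv)
  exact ⟨(isAlgebraic_algebraMap_iff (A := ℂ) Complex.ofReal_injective).mp hre,
    (isAlgebraic_algebraMap_iff (A := ℂ) Complex.ofReal_injective).mp him⟩

/-- Extending a `Fin s`-family of reals satisfying a predicate by one more such real. [folklore] -/
private theorem loopLF_forall_cons {s : ℕ} {p : ℝ → Prop} {x : ℝ} {f : Fin s → ℝ} (hx : p x)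
    (hf : ∀ i, p (f i)) : ∀ i, p ((Fin.cons x f : Fin (s + 1) → ℝ) i) :=
  Fin.cases (by simpa using hx) (fun i => by simpa using hf i)

/-! ## Induction over the roots in `ℚ̄ = algebraicClosure ℚ ℂ` -/

/-- The splitting over `ℚ̄[X]`: for `P ∈ ℚ̄[X]` of degree `≤ n` without zeros on `[0,1] ⊆ ℂ`, the
angular density `ω(P(u), P′(u))` is on `[0,1]` a finite sum of angular derivatives of linear loops
`(a u + b) + i(c u + d)` with real algebraic coefficients and `a u + b > 0` on `[0,1]` (induction on
`n`, peeling one root of `P` in the algebraically closed field `ℚ̄`). [folklore] -/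
private theorem loopLF_induct (n : ℕ) : ∀ P : (algebraicClosure ℚ ℂ)[X], P.natDegree ≤ n →
    (∀ u ∈ Set.Icc (0:ℝ) 1, aeval (u:ℂ) P ≠ 0) →
    ∃ (s : ℕ) (a b c d : Fin s → ℝ), (∀ i, IsAlgebraic ℚ (a i)) ∧ (∀ i, IsAlgebraic ℚ (b i)) ∧
      (∀ i, IsAlgebraic ℚ (c i)) ∧ (∀ i, IsAlgebraic ℚ (d i)) ∧
      (∀ i, ∀ u ∈ Set.Icc (0:ℝ) 1, 0 < a i * u + b i) ∧
      ∀ u ∈ Set.Icc (0:ℝ) 1,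
        ((aeval (u:ℂ) P).re * (aeval (u:ℂ) (derivative P)).im -
              (aeval (u:ℂ) (derivative P)).re * (aeval (u:ℂ) P).im) /
            ((aeval (u:ℂ) P).re ^ 2 + (aeval (u:ℂ) P).im ^ 2) =
          ∑ i, (b i * c i - a i * d i) / ((a i * u + b i) ^ 2 + (c i * u + d i) ^ 2) := by
  induction n with
  | zero =>
    intro P hP _
    refine ⟨0, Fin.elim0, Fin.elim0, Fin.elim0, Fin.elim0, fun i => i.elim0, fun i => i.elim0,
      fun i => i.elim0, fun i => i.elim0, fun i => i.elim0, fun u _ => ?_⟩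
    rw [eq_C_of_natDegree_le_zero hP, derivative_C, map_zero]
    simp
  | succ n ih =>
    intro P hP h0
    by_cases hdeg : P.natDegree ≤ n
    · exact ih P hdeg h0
    -- `P` has positive degree: peel a root `w ∈ ℚ̄`
    haveI : IsAlgClosed (algebraicClosure ℚ ℂ) := (algebraicClosure.isAlgClosure ℚ ℂ).isAlgClosed
    obtain ⟨w, hw⟩ := IsAlgClosed.exists_root P
      (natDegree_pos_iff_degree_pos.1 (by omega)).ne'
    obtain ⟨w₀, hw₀⟩ : ∃ w₀ : ℂ, w₀ = algebraMap (algebraicClosure ℚ ℂ) ℂ w := ⟨_, rfl⟩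
    obtain ⟨Q, hQ⟩ : ∃ Q : (algebraicClosure ℚ ℂ)[X], Q = P /ₘ (X - C w) := ⟨_, rfl⟩
    have hPQ : (X - C w) * Q = P := by rw [hQ]; exact mul_divByMonic_eq_iff_isRoot.2 hw
    have hQdeg : Q.natDegree ≤ n := by
      rw [hQ, natDegree_divByMonic P (monic_X_sub_C w), natDegree_X_sub_C]
      omega
    have hevL : ∀ u : ℝ, aeval (u:ℂ) (X - C w) = (u:ℂ) - w₀ := fun u => by
      rw [map_sub, aeval_X, aeval_C, hw₀]
    have hevP : ∀ u : ℝ, aeval (u:ℂ) P = ((u:ℂ) - w₀) * aeval (u:ℂ) Q := fun u => by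
      rw [← hPQ, map_mul, hevL]
    have hevP' : ∀ u : ℝ, aeval (u:ℂ) (derivative P) =
        1 * aeval (u:ℂ) Q + ((u:ℂ) - w₀) * aeval (u:ℂ) (derivative Q) := fun u => by
      rw [← hPQ, derivative_mul, map_add, map_mul, map_mul, hevL, derivative_X_sub_C, map_one]
    have hL0 : ∀ u ∈ Set.Icc (0:ℝ) 1, (u:ℂ) - w₀ ≠ 0 := fun u hu h =>
      h0 u hu (by rw [hevP, h, zero_mul])
    have hQ0 : ∀ u ∈ Set.Icc (0:ℝ) 1, aeval (u:ℂ) Q ≠ 0 := fun u hu h =>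
      h0 u hu (by rw [hevP, h, mul_zero])
    obtain ⟨s, a, b, c, d, ha, hb, hc, hd, hpos, hsum⟩ := ih Q hQdeg hQ0
    -- `Re w`, `Im w` are real algebraic numbers
    have hwalg : IsAlgebraic ℚ w₀ := by
      rw [hw₀, IntermediateField.algebraMap_apply]
      exact mem_algebraicClosure_iff.1 w.2
    obtain ⟨hre, him⟩ := loopLF_re_im hwalg
    rcases lt_trichotomy w₀.im 0 with hlt | heq | hgt
    · -- `Im w < 0`: the new linear loop is `i (u − w) = −Im w + i (u − Re w)`
      refine ⟨s + 1, Fin.cons 0 a, Fin.cons (-w₀.im) b, Fin.cons (-1) c, Fin.cons w₀.re d,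
        loopLF_forall_cons isAlgebraic_zero ha, loopLF_forall_cons him.neg hb,
        loopLF_forall_cons isAlgebraic_one.neg hc, loopLF_forall_cons hre hd, ?_, fun u hu => ?_⟩
      · refine Fin.cases (fun u _ => ?_) (fun i u hu => ?_)
        · simp only [Fin.cons_zero]
          linarith
        · simp only [Fin.cons_succ]
          exact hpos i u hu
      · rw [hevP u, hevP' u, loopLF_ang_mul _ _ _ _ (hL0 u hu) (hQ0 u hu), loopLF_ang_linear,
          hsum u hu, Fin.sum_univ_succ]
        simp only [Fin.cons_zero, Fin.cons_succ]
        congr 1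
        ring
    · -- `Im w = 0`: a real root contributes nothing
      refine ⟨s, a, b, c, d, ha, hb, hc, hd, hpos, fun u hu => ?_⟩
      rw [hevP u, hevP' u, loopLF_ang_mul _ _ _ _ (hL0 u hu) (hQ0 u hu), loopLF_ang_linear,
        hsum u hu, heq, zero_div, zero_add]
    · -- `Im w > 0`: the new linear loop is `−i (u − w) = Im w + i (Re w − u)`
      refine ⟨s + 1, Fin.cons 0 a, Fin.cons w₀.im b, Fin.cons 1 c, Fin.cons (-w₀.re) d,
        loopLF_forall_cons isAlgebraic_zero ha, loopLF_forall_cons him hb,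
        loopLF_forall_cons isAlgebraic_one hc, loopLF_forall_cons hre.neg hd, ?_, fun u hu => ?_⟩
      · refine Fin.cases (fun u _ => ?_) (fun i u hu => ?_)
        · simp only [Fin.cons_zero]
          linarith
        · simp only [Fin.cons_succ]
          exact hpos i u hu
      · rw [hevP u, hevP' u, loopLF_ang_mul _ _ _ _ (hL0 u hu) (hQ0 u hu), loopLF_ang_linear,
          hsum u hu, Fin.sum_univ_succ]
        simp only [Fin.cons_zero, Fin.cons_succ]
        congr 1
        ring

/-! ## The stub -/

/-- STUB (rung 9, V3) **linear factors of a polynomial loop, rotated into the right half-plane.**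
For a zero-free complex polynomial loop `P = A + iB` on `[0,1]` (real polynomials with `ℚ`-algebraic
coefficients, `A² + B² ≠ 0` on `[0,1]`), the angular derivative `(A B′ − A′ B)/(A² + B²) = Im(P′/P)`
is on `[0,1]` a finite sum `Σᵢ (bᵢcᵢ − aᵢdᵢ)/((aᵢu + bᵢ)² + (cᵢu + dᵢ)²)` of angular derivatives of
linear loops `(aᵢu + bᵢ) + i(cᵢu + dᵢ)` with real algebraic coefficients and `aᵢu + bᵢ > 0` on
`[0,1]` (one loop `∓i(u − w)` per non-real root `w` of `P`, counted with multiplicity; `P′/P = Σ_w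
1/(u − w)`). [folklore] -/
theorem stub_loopLinearFactors :
    ∀ (A B : Polynomial ℝ), (∀ n, IsAlgebraic ℚ (A.coeff n)) → (∀ n, IsAlgebraic ℚ (B.coeff n)) →
      (∀ u ∈ Set.Icc (0:ℝ) 1, A.eval u ^ 2 + B.eval u ^ 2 ≠ 0) →
      ∃ (s : ℕ) (a b c d : Fin s → ℝ), (∀ i, IsAlgebraic ℚ (a i)) ∧ (∀ i, IsAlgebraic ℚ (b i)) ∧
        (∀ i, IsAlgebraic ℚ (c i)) ∧ (∀ i, IsAlgebraic ℚ (d i)) ∧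
        (∀ i, ∀ u ∈ Set.Icc (0:ℝ) 1, 0 < a i * u + b i) ∧
        ∀ u ∈ Set.Icc (0:ℝ) 1,
          (A.eval u * (Polynomial.derivative B).eval u - (Polynomial.derivative A).eval u * B.eval u) /
              (A.eval u ^ 2 + B.eval u ^ 2) =
            ∑ i, (b i * c i - a i * d i) / ((a i * u + b i) ^ 2 + (c i * u + d i) ^ 2) := by
  intro A B hA hB h0
  -- the complex polynomial `A + iB`
  obtain ⟨Pc, hPc⟩ :
      ∃ Pc : ℂ[X], Pc = A.map Complex.ofRealHom + C Complex.I * B.map Complex.ofRealHom :=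
    ⟨_, rfl⟩
  have hI : IsAlgebraic ℚ Complex.I :=
    ⟨X ^ 2 + 1, by simpa using (monic_X_pow_add_C (1:ℚ) two_ne_zero).ne_zero, by simp⟩
  -- its lift to `ℚ̄[X]`
  obtain ⟨P, hP⟩ : ∃ P : (algebraicClosure ℚ ℂ)[X], P.map (algebraMap _ ℂ) = Pc := by
    rw [← mem_lifts, lifts_iff_coeff_lifts]
    intro n
    have hAn : IsAlgebraic ℚ ((A.coeff n : ℝ) : ℂ) :=
      (isAlgebraic_algebraMap_iff (A := ℂ) Complex.ofReal_injective).2 (hA n)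
    have hBn : IsAlgebraic ℚ ((B.coeff n : ℝ) : ℂ) :=
      (isAlgebraic_algebraMap_iff (A := ℂ) Complex.ofReal_injective).2 (hB n)
    have halg : IsAlgebraic ℚ (Pc.coeff n) := by
      rw [hPc, coeff_add, coeff_map, coeff_C_mul, coeff_map, Complex.ofRealHom_eq_coe,
        Complex.ofRealHom_eq_coe]
      exact hAn.add (hI.mul hBn)
    exact ⟨⟨Pc.coeff n, mem_algebraicClosure_iff.2 halg⟩, rfl⟩
  -- values at real points
  have hev : ∀ u : ℝ, Pc.eval (u:ℂ) = ((A.eval u : ℝ) : ℂ) + Complex.I * ((B.eval u : ℝ) : ℂ) :=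
      fun u => by
    rw [hPc, eval_add, eval_mul, eval_C, eval_map, eval_map, ← Complex.ofRealHom_eq_coe u,
      eval₂_hom, eval₂_hom]
    rfl
  have hev' : ∀ u : ℝ, (derivative Pc).eval (u:ℂ) =
      (((derivative A).eval u : ℝ) : ℂ) + Complex.I * (((derivative B).eval u : ℝ) : ℂ) :=
      fun u => by
    rw [hPc, derivative_add, derivative_mul, derivative_C, zero_mul, zero_add, derivative_map,
      derivative_map, eval_add, eval_mul, eval_C, eval_map, eval_map, ← Complex.ofRealHom_eq_coe u,
      eval₂_hom, eval₂_hom]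
    rfl
  have haev : ∀ u : ℝ, aeval (u:ℂ) P = ((A.eval u : ℝ) : ℂ) + Complex.I * ((B.eval u : ℝ) : ℂ) :=
      fun u => by
    rw [aeval_def, ← eval_map, hP, hev]
  have haev' : ∀ u : ℝ, aeval (u:ℂ) (derivative P) =
      (((derivative A).eval u : ℝ) : ℂ) + Complex.I * (((derivative B).eval u : ℝ) : ℂ) :=
      fun u => by
    rw [aeval_def, ← eval_map, ← derivative_map, hP, hev']
  have hre : ∀ x y : ℝ, ((x:ℂ) + Complex.I * (y:ℂ)).re = x := fun x y => by simp
  have him : ∀ x y : ℝ, ((x:ℂ) + Complex.I * (y:ℂ)).im = y := fun x y => by simp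
  have hP0 : ∀ u ∈ Set.Icc (0:ℝ) 1, aeval (u:ℂ) P ≠ 0 := fun u hu h => by
    rw [haev] at h
    have h1 : A.eval u = 0 := by simpa using congrArg Complex.re h
    have h2 : B.eval u = 0 := by simpa using congrArg Complex.im h
    exact h0 u hu (by rw [h1, h2]; norm_num)
  obtain ⟨s, a, b, c, d, ha, hb, hc, hd, hpos, hsum⟩ := loopLF_induct P.natDegree P le_rfl hP0
  refine ⟨s, a, b, c, d, ha, hb, hc, hd, hpos, fun u hu => ?_⟩
  rw [← hsum u hu, haev, haev']
  simp only [hre, him]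

end Summit.KontsevichZagierPeriods.KontsevichZagierPeriods.Cruxes.StokesGeneration.FibrewiseStokes

end
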